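import Literature.AlgebraicGeometry.Resolution.ValuationCentre
import Literature.AlgebraicGeometry.Resolution.ResolutionOfIsoLocus
import Literature.AlgebraicGeometry.Resolution.ChowLemmaProofs
import Literature.AlgebraicGeometry.Motives.VarietiesProperProofs
import Mathlib.AlgebraicGeometry.SpreadingOut
import Mathlib.AlgebraicGeometry.FunctionField
import HarnessLib

/-!
# Projective models of a function field and their centres

Topic: `Literature/AlgebraicGeometry/Resolution`. The objects of Zariski's patching theorem
(Zariski 1944, "Fundamental theorem", Ann. Math. 45, p. 539; Zariski–Samuel II, Ch. VI §17;
Piltant 2013, §2 and §5; Cossart–Piltant 2019, proof of Prop. 4.6 [arXiv v1: 4.4], Step 3):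
PROJECTIVE MODELS of a field `K` over a ground field `k` and the CENTRE of a valuation of
`K/k` on such a model, built on the tree's `KModel` (`ValuationCentre.lean`: models over a base
ring `A`, centres via Mathlib's valuative criteria) with `A = k`. Everything here is PROVED.

* `ProjModel k K` — a projective model of `K/k`: a `KModel k K` (a `k`-scheme `X` with a
  `K`-point `gen : Spec K → X` over `k`) such that `X` is integral, `X → Spec k` is projective
  (`Literature.AlgebraicGeometry.Motives.IsProjectiveOver`: a closed `k`-immersion into some
  `ℙⁿ_k` exists), `gen` is the generic point and identifies `K` with the function field
  (`𝒪_{X,ξ} → K` an isomorphism) — Piltant 2013, §2: "proper/projective model `X/k` of `K`".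
* `ProjModel.centre M v` — THE centre of `𝒪_v ∈ Zar(K/k)` on `M` (exists: `X → Spec k` is
  proper; unique: separated), `ProjModel.RegCentre M v` — "the centre of `v` is a regular point"
  (Piltant's `x_V ∈ Reg(X)`, Zariski's "simple centre").
* `ProjModel.Hom` — morphisms of models (= `KModel.Hom`), `Hom.comp`, `Hom.map_centre`
  (centres map to centres), `Hom.RegLe φ` — `φ⁻¹(Reg M) ⊆ Reg N`, the conclusion shape of the
  patching theorem — and `RegCentre.of_hom`.
* `ProjModel.isRegular_of_forall_regCentre` — a model all of whose centres are regular is a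
  regular scheme (every point is a centre, `KModel.exists_isCentre_of_isGenericPoint`).
* `ProjModel.Hom.exists_isIso_morphismRestrict` — **a morphism of projective models of the
  same field is birational**: it is an isomorphism over a non-empty open of the target, with
  dense preimage (spread the `K`-point of the source to a rational section, Mathlib
  `spread_out_of_isGermInjective`, Stacks 0BX6; a dominant section of a separated morphism to a
  reduced scheme forces an isomorphism over that open, `ChowLemmaProof.isIso_morphismRestrict_of_section`).
* `ProjModel.Hom.hasResolution` — hence a model dominated by a REGULAR model has a resolution
  of singularities in the weak sense of this tree (`Scheme.HasResolution`).

These are the bookkeeping facts by which a finite resolving system is patched into a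
resolution (Zariski–Samuel II, Ch. VI §17; Piltant 2013, Cor. 5.7; Cossart–Piltant 2019,
Prop. 4.6, Step 3), used by the reduction of `CossartPiltant2019Patching`
(`ArithmeticalThreefolds.lean`) to the two-model patching statement.

## References

* O. Zariski, P. Samuel, *Commutative Algebra* II, Ch. VI §17 (models, centres, domination).
  [ZariskiSamuel1960]
* O. Piltant, *An axiomatic version of Zariski's patching theorem*, RACSAM 107 (2013) 91–121,
  §2 (models, centres, Axiom 5), §5 (Prop. 5.1, Cor. 5.7).
* V. Cossart, O. Piltant, J. Algebra 529 (2019), proof of Prop. 4.6 (arXiv:1412.0868v1: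
  Prop. 4.4), Step 3. [CossartPiltant2019]
* The Stacks Project, Tags 01KF, 01KZ (valuative criteria), 0BX6 (spreading out).
  [StacksProject]
-/

noncomputable section

open CategoryTheory AlgebraicGeometry TopologicalSpace IsLocalRing

namespace Literature.AlgebraicGeometry.Resolution

universe u

/-- A **projective model of `K` over `k`** (Zariski–Samuel II, Ch. VI §17; Piltant 2013, §2:
"projective model `X/k` of `K`"): a `k`-scheme `π : X → Spec k` with a `K`-point
`gen : Spec K → X` over `k` (a `KModel k K`) such that `X` is integral, `X` is projective over
`k` (admits a closed `k`-immersion into some `ℙⁿ_k`), `gen` hits the generic point and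
`𝒪_{X,ξ} → K` is an isomorphism (so `K` is the function field of `X` and `gen` its generic
point). [cite: ZariskiSamuel1960, Ch. VI §17] -/
structure ProjModel (k K : Type u) [Field k] [Field K] [Algebra k K] extends KModel k K where
  /-- The underlying scheme is integral. -/
  isIntegral : IsIntegral X
  /-- `X → Spec k` is projective. -/
  isProjectiveOver : Motives.IsProjectiveOver (Over.mk π)
  /-- The distinguished `K`-point is the generic point. -/
  genericPt_eq : gen (closedPoint K) = genericPoint X
  /-- `K` is the function field: `𝒪_{X,ξ} → K` is an isomorphism. -/
  isIso_stalkClosedPointTo : IsIso (Scheme.stalkClosedPointTo gen)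

namespace ProjModel

variable {k K : Type u} [Field k] [Field K] [Algebra k K]

/-- The underlying scheme of a projective model is integral. [folklore] -/
instance isIntegral' (M : ProjModel k K) : IsIntegral M.X :=
  M.isIntegral

/-- `𝒪_{X,ξ} → K` is an isomorphism. [folklore] -/
instance isIso_stalkClosedPointTo' (M : ProjModel k K) :
    IsIso (Scheme.stalkClosedPointTo M.gen) :=
  M.isIso_stalkClosedPointTo

/-- The structure morphism of a projective model is proper. [folklore] -/
instance isProper (M : ProjModel k K) : IsProper M.π :=
  M.isProjectiveOver.isProper

/-- A projective model is locally Noetherian (of finite type over a field). [folklore] -/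
instance isLocallyNoetherian (M : ProjModel k K) : IsLocallyNoetherian M.X :=
  LocallyOfFiniteType.isLocallyNoetherian M.π

/-- A projective model is quasi-compact. [folklore] -/
instance compactSpace (M : ProjModel k K) : CompactSpace M.X :=
  QuasiCompact.compactSpace_of_compactSpace M.π

/-- A projective model is Noetherian. [folklore] -/
instance isNoetherian (M : ProjModel k K) : IsNoetherian M.X := {}

/-- The distinguished point of the underlying `KModel` is the generic point. [folklore] -/
theorem genericPt_eq' (M : ProjModel k K) : M.toKModel.genericPt = genericPoint M.X :=
  M.genericPt_eq

/-! ## The centre of a valuation -/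

/-- **The centre** of the valuation ring `𝒪_v ∈ Zar(K/k)` on the projective model `M`: the
image of the closed point under the unique lift `Spec 𝒪_v → X` of `gen` (existence by
properness, `KModel.exists_isCentre`; Zariski–Samuel II, Ch. VI §17; Piltant 2013, §2: "for any
proper model `X/k` of `K`, `V` has a unique center `x_V ∈ X`").
[cite: ZariskiSamuel1960, Ch. VI §17] -/
def centre (M : ProjModel k K) (v : ZariskiRiemannSpace k K) : M.X :=
  (M.toKModel.exists_isCentre v).choose

/-- The centre is a centre. [folklore] -/
theorem isCentre_centre (M : ProjModel k K) (v : ZariskiRiemannSpace k K) :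
    M.IsCentre v (M.centre v) :=
  (M.toKModel.exists_isCentre v).choose_spec

/-- Uniqueness: every centre of `v` on `M` is `M.centre v` (separatedness). [folklore] -/
theorem eq_centre_of_isCentre {M : ProjModel k K} {v : ZariskiRiemannSpace k K} {x : M.X}
    (hx : M.IsCentre v x) : x = M.centre v :=
  hx.unique (M.isCentre_centre v)

/-- **`v` has a regular centre on `M`**: the local ring of `M` at the centre of `v` is a regular
local ring (Zariski: "simple centre"; Piltant 2013, Axiom 5: `x_V ∈ Reg(X)`).
[cite: ZariskiSamuel1960, Ch. VI §17] -/
def RegCentre (M : ProjModel k K) (v : ZariskiRiemannSpace k K) : Prop :=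
  IsRegularLocalRing (M.X.presheaf.stalk (M.centre v))

/-- `RegCentre` via any centre. [folklore] -/
theorem regCentre_iff {M : ProjModel k K} {v : ZariskiRiemannSpace k K} :
    M.RegCentre v ↔ ∃ x : M.X, M.IsCentre v x ∧ IsRegularLocalRing (M.X.presheaf.stalk x) := by
  constructor
  · exact fun h => ⟨_, M.isCentre_centre v, h⟩
  · rintro ⟨x, hx, hreg⟩
    rw [eq_centre_of_isCentre hx] at hreg
    exact hreg

/-- **A projective model all of whose centres are regular is a regular scheme**: every point
of an integral model is the centre of some valuation ring of `K/k`
(`KModel.exists_isCentre_of_isGenericPoint`). This is how the patched model of Zariski's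
theorem is seen to be non-singular (Zariski–Samuel II, Ch. VI §17; Piltant 2013, Cor. 5.7).
[cite: ZariskiSamuel1960, Ch. VI §17] -/
theorem isRegular_of_forall_regCentre {M : ProjModel k K} (h : ∀ v, M.RegCentre v) :
    Scheme.IsRegular M.X := by
  intro x
  have hgen : IsGenericPoint M.toKModel.genericPt (Set.univ : Set M.X) := by
    rw [M.genericPt_eq']
    exact genericPoint_spec M.X
  obtain ⟨v, hv⟩ := M.toKModel.exists_isCentre_of_isGenericPoint hgen x
  rw [eq_centre_of_isCentre hv]
  exact h v

/-! ## Morphisms of models -/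

/-- A **morphism of projective models** of `K/k`: a `k`-morphism compatible with the generic
points (`KModel.Hom`; Zariski–Samuel's domination). [cite: ZariskiSamuel1960, Ch. VI §17] -/
abbrev Hom (N M : ProjModel k K) : Type u :=
  KModel.Hom N.toKModel M.toKModel

variable {L N M : ProjModel k K}

/-- Composition of morphisms of models. [folklore] -/
def Hom.comp (ψ : Hom L N) (φ : Hom N M) : Hom L M where
  f := ψ.f ≫ φ.f
  f_π := by rw [Category.assoc, φ.f_π, ψ.f_π]
  gen_f := by rw [← Category.assoc, ψ.gen_f, φ.gen_f]

/-- The underlying morphism of a composite. [folklore] -/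
@[simp]
theorem Hom.comp_f (ψ : Hom L N) (φ : Hom N M) : (ψ.comp φ).f = ψ.f ≫ φ.f := rfl

/-- **Centres map to centres** under a morphism of models (Zariski–Samuel II, Ch. VI §17,
Lemmas 3–4). [cite: ZariskiSamuel1960, Ch. VI §17] -/
theorem Hom.map_centre (φ : Hom N M) (v : ZariskiRiemannSpace k K) :
    φ.f (N.centre v) = M.centre v :=
  eq_centre_of_isCentre ((N.isCentre_centre v).map φ)

/-- The underlying morphism of a morphism of projective models is proper. [folklore] -/
instance Hom.isProper (φ : Hom N M) : IsProper φ.f := by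
  haveI : IsProper (φ.f ≫ M.π) := by rw [φ.f_π]; infer_instance
  exact IsProper.of_comp φ.f M.π

/-- **`φ⁻¹(Reg M) ⊆ Reg N`**: the morphism of models `φ : N → M` does not destroy regularity —
every point of `N` lying over a regular point of `M` is regular (the conclusion
`πᵢ⁻¹(Reg 𝒳ᵢ) ⊆ Reg 𝒴` of the patching problem, Cossart–Piltant 2019, proof of Prop. 4.6,
Step 3; Piltant 2013, Prop. 5.1). [cite: CossartPiltant2019, Prop. 4.6 (arXiv v1: Prop. 4.4), proof, Step 3] -/
def Hom.RegLe (φ : Hom N M) : Prop :=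
  ∀ y : N.X, IsRegularLocalRing (M.X.presheaf.stalk (φ.f y)) →
    IsRegularLocalRing (N.X.presheaf.stalk y)

/-- Regular centres lift along morphisms with `φ⁻¹(Reg M) ⊆ Reg N`. [folklore] -/
theorem RegCentre.of_hom (φ : Hom N M) (hφ : φ.RegLe) {v : ZariskiRiemannSpace k K}
    (h : M.RegCentre v) : N.RegCentre v := by
  apply hφ
  rw [φ.map_centre v]
  exact h

/-- `RegLe` is stable under composition. [folklore] -/
theorem Hom.RegLe.comp {ψ : Hom L N} {φ : Hom N M} (hψ : ψ.RegLe) (hφ : φ.RegLe) :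
    (ψ.comp φ).RegLe :=
  fun y h => hψ y (hφ (ψ.f y) (by rwa [Hom.comp_f, Scheme.Hom.comp_apply] at h))

/-! ## Morphisms of models are birational -/

/-- Points of `Spec K`, `K` a field, are all equal to the closed point. [folklore] -/
theorem eq_closedPoint_of_field (p : ↥(Spec (CommRingCat.of K))) : p = closedPoint K := by
  have h1 : (p : PrimeSpectrum K).asIdeal = ⊥ := by
    rcases Ideal.eq_bot_or_top (p : PrimeSpectrum K).asIdeal with h | h
    · exact h
    · exact absurd h (p : PrimeSpectrum K).isPrime.ne_top
  have h2 : (closedPoint K : PrimeSpectrum K).asIdeal = ⊥ := by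
    rcases Ideal.eq_bot_or_top (closedPoint K : PrimeSpectrum K).asIdeal with h | h
    · exact h
    · exact absurd h (closedPoint K : PrimeSpectrum K).isPrime.ne_top
  exact PrimeSpectrum.ext (h1.trans h2.symm)

/-- **A morphism of projective models of the same field is birational**: there is a non-empty
open `U` of the target over which it is an isomorphism, with dense preimage. Proof: the
`K`-point `gen_N : Spec K = Spec 𝒪_{M,ξ} → N` is an `M`-morphism from the spectrum of the local
ring of `M` at its generic point; it spreads out to a section `s : U → N` of `φ` over an open
`U ∋ ξ` (Stacks 0BX6), whose image contains the generic point of `N`; a dominant section of a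
separated morphism to a reduced scheme is an isomorphism onto the full preimage
(`ChowLemmaProof.isIso_morphismRestrict_of_section`). (Zariski–Samuel II, Ch. VI §17: two models
with a domination are birationally equivalent, the domination being biregular at the generic
point.) [cite: StacksProject, Tag 0BX6] -/
theorem Hom.exists_isIso_morphismRestrict (φ : Hom N M) :
    ∃ U : M.X.Opens, (U : Set M.X).Nonempty ∧ IsIso (φ.f ∣_ U) ∧
      Dense ((φ.f ⁻¹ᵁ U : N.X.Opens) : Set N.X) := by
  haveI : IsSeparated (φ.f ≫ M.π) := by rw [φ.f_π]; infer_instance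
  haveI : IsSeparated φ.f := IsSeparated.of_comp φ.f M.π
  haveI : LocallyOfFiniteType (φ.f ≫ M.π) := by rw [φ.f_π]; infer_instance
  haveI : LocallyOfFiniteType φ.f := locallyOfFiniteType_of_comp φ.f M.π
  -- the generic point of `M` and the identification `Spec K ≅ Spec 𝒪_{M,ξ}`
  set x : M.X := M.gen (closedPoint K) with hxdef
  let e : M.X.presheaf.stalk x ≅ CommRingCat.of K := asIso (Scheme.stalkClosedPointTo M.gen)
  let g : Spec (M.X.presheaf.stalk x) ⟶ N.X := Spec.map e.inv ≫ N.gen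
  have he : Spec.map e.hom ≫ M.X.fromSpecStalk x = M.gen :=
    Scheme.Spec_stalkClosedPointTo_fromSpecStalk M.gen
  have hg : g ≫ φ.f = M.X.fromSpecStalk x ≫ 𝟙 M.X := by
    rw [Category.comp_id, Category.assoc, φ.gen_f, ← he, ← Category.assoc, ← Spec.map_comp,
      Iso.hom_inv_id, Spec.map_id, Category.id_comp]
  obtain ⟨U, hxU, s, hs₁, hs₂⟩ :=
    spread_out_of_isGermInjective' (sX := 𝟙 M.X) (sY := φ.f) g hg
  rw [Category.comp_id] at hs₂
  -- the section hits the generic point of `N`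
  have hpt : U.fromSpecStalkOfMem x hxU (closedPoint (M.X.presheaf.stalk x)) = ⟨x, hxU⟩ := by
    apply U.ι.injective
    rw [← Scheme.Hom.comp_apply, Scheme.Opens.fromSpecStalkOfMem_ι, Scheme.fromSpecStalk_closedPoint]
    rfl
  have hsx : s ⟨x, hxU⟩ = genericPoint N.X := by
    have h1 : g (closedPoint (M.X.presheaf.stalk x)) = s ⟨x, hxU⟩ := by
      rw [hs₁, Scheme.Hom.comp_apply, hpt]
    rw [← h1]
    change N.gen (Spec.map e.inv (closedPoint _)) = _
    rw [eq_closedPoint_of_field (Spec.map e.inv (closedPoint _))]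
    exact N.genericPt_eq
  haveI : IsDominant s := by
    refine ⟨dense_iff_closure_eq.mpr (Set.eq_univ_of_univ_subset ?_)⟩
    have h := (genericPoint_spec N.X).def
    rw [← hsx] at h
    calc (Set.univ : Set N.X) = closure {s ⟨x, hxU⟩} := h.symm
      _ ⊆ closure (Set.range s) := closure_mono (Set.singleton_subset_iff.mpr ⟨_, rfl⟩)
  obtain ⟨hiso, hdense⟩ := ChowLemmaProof.isIso_morphismRestrict_of_section φ.f U s hs₂
  exact ⟨U, ⟨x, hxU⟩, hiso, hdense⟩

/-- A morphism of projective models is birational in the sense of this tree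
(`IsBirational`: an isomorphism over a dense open with dense preimage). [folklore] -/
theorem Hom.isBirational (φ : Hom N M) : IsBirational φ.f := by
  obtain ⟨U, hU, hiso, hdense⟩ := φ.exists_isIso_morphismRestrict
  exact ⟨U, U.2.dense hU, hdense, hiso⟩

/-- **A projective model dominated by a regular projective model has a resolution of
singularities** (weak form: the domination `N → M` is proper and an isomorphism over a dense
open; `hasResolution_of_isIso_morphismRestrict`). The exit of Zariski's patching argument
(Zariski–Samuel II, Ch. VI §17; Cossart–Piltant 2019, proof of Prop. 4.6, Step 3).
[cite: CossartPiltant2019, Prop. 4.6 (arXiv v1: Prop. 4.4), proof, Step 3] -/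
theorem Hom.hasResolution (φ : Hom N M) (hN : Scheme.IsRegular N.X) :
    Scheme.HasResolution M.X := by
  obtain ⟨U, hU, hiso, -⟩ := φ.exists_isIso_morphismRestrict
  exact hasResolution_of_isIso_morphismRestrict φ.f hN U (U.2.dense hU) hiso

end ProjModel

end Literature.AlgebraicGeometry.Resolution

end
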